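import Summits.ResolutionOfSingularities.ResolutionOfSingularities.Theorems.EquisingularLiftEquisingularLiftNatPointTailEmbDim
import Summits.ResolutionOfSingularities.ResolutionOfSingularities.Theorems.EquisingularLiftEquisingularLiftNatMultisectionAdapterDim
import Summits.ResolutionOfSingularities.ResolutionOfSingularities.Theorems.EquisingularLiftEquisingularLiftNatDeltaIsoInv
import HarnessLib

/-!
# [OURS · L1 W4.5(b) · EL♮] «POINTS ARE FREE»: T-TAIL and T-Δ-ISO with the multisection device fully discharged
# (T-MULTISEC p510326 + adapter p513364 + T-DIM p513633) — crux `EquisingularLiftNat` = stmt-ResolutionOfSingularities-20038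

HONEST FRAMING. OURS (cell res-hironaka, crux chain w45b, slot W4.5(b)); NOT a statement of any manuscript; AI-written,
weaker than expert review. Helper `--supports stmt-ResolutionOfSingularities-20038 --as helper`. Pure assembly (CHAIN v7.3 §1
(ii) «T-ISO-2 is one call»): res-D-pv-013's T-TAIL / T-Δ-ISO-Inv take an abstract device `(Adm, hAdm, hMS)`; the adapter
`hMS_of_multisection` (p513364) supplies it for `Adm Γ x :⟺ μ(𝔪_{Γ,x}) ≤ n` modulo a per-stage dimension input `hdim`, and
res-L1-w45b-stub-2's T-DIM `ringKrullDim_stalk_eq_succ_of_chain` (p513633, in the adapter's shape: p514806) discharges `hdim`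
for `q` smooth of relative dimension `n`. What remains for a caller: `P` integral, `q` smooth of relative dimension `n` and proper, `O` a COMPLETE DVR with
ALGEBRAICALLY CLOSED residue field — all available for `ℙⁿ_{𝕎(k)}`.

(T-DIM in the adapter's `hdim` shape and the `hdim`-free device are res-L1-w45b-stub-2's `hdim_of_smoothOfRelativeDimension` /
`hMS_of_multisection_of_smoothOfRelativeDimension`, p514806, imported.)
* `horizChainE1_of_pointResolvableInv_multisection` — T-TAIL (iso-invariant closure), device discharged.
* `horizChainE1_of_twoSteps_pointResolvableInv_multisection` — res-D-pv-013's T-Δ-ISO-Inv (two explicit steps, then points),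
  device discharged.
(The item's `q`-spelling over `ℙⁿ_O` — `elNatBody_of_twoSteps_pointResolvableInv` with the device discharged — is the same call
with `Proj.isIntegral`, `smoothOfRelativeDimension_toSpecZero_specMap` and `κ(O) ≅ k`; it needs the graded-ring instance of the
sibling file and is left to the specimen assemblies.)

References: Matsumura, *Commutative Ring Theory*, Thm. 8.4, 14.2, 15.6 [Matsumura1987] — through the cited tree files.
-/

set_option linter.dupNamespace false -- mandated namespace `Summit.<Summit>.<Problem>` of this single-conjunct summit

noncomputable section

open CategoryTheory CategoryTheory.Limits AlgebraicGeometry TopologicalSpace Topology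

open Literature.AlgebraicGeometry.Resolution
open AlgebraicGeometry.Scheme.IdealSheafData
open Summit.ResolutionOfSingularities.ResolutionOfSingularities.Theses.EquisingularLift.Split
open Summit.ResolutionOfSingularities.ResolutionOfSingularities.Cruxes.EquisingularLift.StrataSplit

namespace Summit.ResolutionOfSingularities.ResolutionOfSingularities.Cruxes.EquisingularLiftNat.Sections

/-! ## T-TAIL, device discharged -/

/-- **T-TAIL (iso-invariant closure), multisection device discharged.** `P` integral, `q` smooth of relative dimension `n`
and proper over a complete DVR `O` with algebraically closed residue field, `Y ⊆ q⁻¹{s₀}` closed irreducible, `Ch`-stages as in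
`pointStep`. If the reduced strict transform of the `Ch`-stage `(X', σ', S')` is isomorphic to `Γ` and a regular scheme is
reached from `Γ` by blow-ups at closed non-regular points `x` with `μ(𝔪_{Γ₁,x}) ≤ n` (closure asked of iso-invariant predicates
only), then some `Ch`-stage has regular reduced strict transform. [folklore packaging; cite: Matsumura1987, Thm. 8.4] -/
theorem horizChainE1_of_pointResolvableInv_multisection (O : Type) [CommRing O] [IsDomain O] [IsDiscreteValuationRing O]
    [IsAdicComplete (IsLocalRing.maximalIdeal O) O] [IsAlgClosed (IsLocalRing.ResidueField O)]
    (P : Scheme.{0}) [IsIntegral P] (q : P ⟶ Spec (.of O)) (n : ℕ) [SmoothOfRelativeDimension n q] (Y : Closeds P)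
    (Ch : ∀ X' : Scheme.{0}, (X' ⟶ P) → Set X' → Prop)
    (hChain : ∀ (X' : Scheme.{0}) (σ : X' ⟶ P) (S : Set X'), Ch X' σ S → Chain P (Y : Set P) X' σ S)
    (hStep : ∀ (X' X'' : Scheme.{0}) (σ' : X' ⟶ P) (S' : Set X') (C : X'.IdealSheafData) (τ : X'' ⟶ X'),
      Ch X' σ' S' → IsBlowup τ C → Scheme.IsRegular C.subscheme → Flat (C.subschemeι ≫ σ' ≫ q) →
      σ' '' (C.support : Set X') ⊆ {x : P | ¬ IsGenericPoint x (Y : Set P)} →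
      (C.support : Set X') ∩ (σ' ≫ q) ⁻¹' {IsLocalRing.closedPoint O} ⊆ S' →
      Ch X'' (τ ≫ σ') (closure (τ ⁻¹' (S' \ (C.support : Set X')))))
    (hqp : IsProper q) (hY : (Y : Set P) ⊆ q ⁻¹' {IsLocalRing.closedPoint O}) (hYirr : IsIrreducible (Y : Set P))
    (X' : Scheme.{0}) (σ' : X' ⟶ P) (S' : Set X') (hCh : Ch X' σ' S')
    (Γ : Scheme.{0}) (e : Γ ≅ (vanishingIdeal (⟨closure S', isClosed_closure⟩ : Closeds X')).subscheme)
    (hres : ∃ Γs : Scheme.{0}, (∀ R : Scheme.{0} → Prop, (∀ (X X' : Scheme.{0}), Nonempty (X ≅ X') → R X → R X') → R Γ →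
      (∀ (Γ₁ Γ₂ : Scheme.{0}) (x : Γ₁) (hx : IsClosed ({x} : Set Γ₁)) (υ : Γ₂ ⟶ Γ₁), R Γ₁ →
        ¬ IsRegularLocalRing (Γ₁.presheaf.stalk x) → (IsLocalRing.maximalIdeal (Γ₁.presheaf.stalk x)).spanFinrank ≤ n →
        IsBlowup υ (vanishingIdeal ⟨{x}, hx⟩) → R Γ₂) → R Γs) ∧
      Scheme.IsRegular Γs) :
    ∃ (X₁ : Scheme.{0}) (σ₁ : X₁ ⟶ P) (S₁ : Set X₁), Ch X₁ σ₁ S₁ ∧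
      Scheme.IsRegular (vanishingIdeal (⟨closure S₁, isClosed_closure⟩ : Closeds X₁)).subscheme :=
  haveI : Smooth q := SmoothOfRelativeDimension.smooth n q
  horizChainE1_of_pointResolvableInv_embDim O P q Y Ch hChain hStep inferInstance hqp hY hYirr n
    (hdim_of_smoothOfRelativeDimension O P q Y Ch hChain hYirr n) X' σ' S' hCh Γ e hres

/-! ## T-Δ-ISO (two explicit steps, then points), device discharged -/

/-- **T-Δ-ISO-Inv (res-D-pv-013 p512624), multisection device discharged** for `Adm :⟺ μ(𝔪_{Γ,x}) ≤ n`: `P` integral, `q` smooth of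
relative dimension `n` and proper, `O` a complete DVR with algebraically closed residue field; two explicit admissible steps with
the five `pointStep` clauses, then a point-resolvable downstairs scheme. [folklore; assembly] -/
theorem horizChainE1_of_twoSteps_pointResolvableInv_multisection (O : Type) [CommRing O] [IsDomain O]
    [IsDiscreteValuationRing O] [IsAdicComplete (IsLocalRing.maximalIdeal O) O] [IsAlgClosed (IsLocalRing.ResidueField O)]
    (P : Scheme.{0}) [IsIntegral P] (q : P ⟶ Spec (.of O)) (n : ℕ) [SmoothOfRelativeDimension n q] (Y : Closeds P)
    (hqp : IsProper q)
    (hY : (Y : Set P) ⊆ q ⁻¹' {IsLocalRing.closedPoint O}) (hYirr : IsIrreducible (Y : Set P))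
    -- step 1 (level 0)
    (C₁ : P.IdealSheafData) (X₁ : Scheme.{0}) (τ₁ : X₁ ⟶ P) (hτ₁ : IsBlowup τ₁ C₁) (hC₁reg : Scheme.IsRegular C₁.subscheme)
    (hC₁flat : Flat (C₁.subschemeι ≫ 𝟙 P ≫ q))
    (hC₁gen : (𝟙 P : P ⟶ P) '' (C₁.support : Set P) ⊆ {x : P | ¬ IsGenericPoint x (Y : Set P)})
    (hC₁E1 : (C₁.support : Set P) ∩ (𝟙 P ≫ q) ⁻¹' {IsLocalRing.closedPoint O} ⊆ (Y : Set P))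
    -- step 2 (level 1), `S₁ = closure τ₁⁻¹(Y ∖ V(C₁))`
    (C₂ : X₁.IdealSheafData) (X₂ : Scheme.{0}) (τ₂ : X₂ ⟶ X₁) (hτ₂ : IsBlowup τ₂ C₂) (hC₂reg : Scheme.IsRegular C₂.subscheme)
    (hC₂flat : Flat (C₂.subschemeι ≫ τ₁ ≫ q))
    (hC₂gen : τ₁ '' (C₂.support : Set X₁) ⊆ {x : P | ¬ IsGenericPoint x (Y : Set P)})
    (hC₂E1 : (C₂.support : Set X₁) ∩ (τ₁ ≫ q) ⁻¹' {IsLocalRing.closedPoint O} ⊆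
      closure (τ₁ ⁻¹' ((Y : Set P) \ (C₁.support : Set P))))
    -- the downstairs scheme after the two steps and its point-resolvability
    (Γ : Scheme.{0})
    (e : Γ ≅ (vanishingIdeal (⟨closure (closure (τ₂ ⁻¹' (closure (τ₁ ⁻¹' ((Y : Set P) \ (C₁.support : Set P))) \
      (C₂.support : Set X₁)))), isClosed_closure⟩ : Closeds X₂)).subscheme)
    (hres : ∃ Γs : Scheme.{0}, (∀ R : Scheme.{0} → Prop, (∀ (X X' : Scheme.{0}), Nonempty (X ≅ X') → R X → R X') → R Γ →
      (∀ (Γ₁ Γ₂ : Scheme.{0}) (x : Γ₁) (hx : IsClosed ({x} : Set Γ₁)) (υ : Γ₂ ⟶ Γ₁), R Γ₁ →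
        ¬ IsRegularLocalRing (Γ₁.presheaf.stalk x) → (IsLocalRing.maximalIdeal (Γ₁.presheaf.stalk x)).spanFinrank ≤ n → IsBlowup υ (vanishingIdeal ⟨{x}, hx⟩) → R Γ₂) → R Γs) ∧
      Scheme.IsRegular Γs) :
    ∃ (P' : Scheme.{0}) (σ : P' ⟶ P) (S' : Set P'),
      (∀ Q : (∀ X' : Scheme.{0}, (X' ⟶ P) → Set X' → Prop), Q P (𝟙 P) (Y : Set P) →
        (∀ (X' X'' : Scheme.{0}) (σ' : X' ⟶ P) (Y' : Set X') (C : X'.IdealSheafData) (τ : X'' ⟶ X'),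
          Q X' σ' Y' → IsBlowup τ C → Scheme.IsRegular C.subscheme → Flat (C.subschemeι ≫ σ' ≫ q) →
          σ' '' (C.support : Set X') ⊆ {x | ¬ IsGenericPoint x (Y : Set P)} →
          (C.support : Set X') ∩ (σ' ≫ q) ⁻¹' {IsLocalRing.closedPoint O} ⊆ Y' →
          Q X'' (τ ≫ σ') (closure (τ ⁻¹' (Y' \ (C.support : Set X'))))) → Q P' σ S') ∧
      Scheme.IsRegular (vanishingIdeal (⟨closure S', isClosed_closure⟩ : Closeds P')).subscheme := by
  haveI : Smooth q := SmoothOfRelativeDimension.smooth n q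
  refine horizChainE1_of_twoSteps_pointResolvableInv O P q Y inferInstance hqp hY hYirr C₁ X₁ τ₁ hτ₁ hC₁reg hC₁flat hC₁gen
    hC₁E1 C₂ X₂ τ₂ hτ₂ hC₂reg hC₂flat hC₂gen hC₂E1 (fun Γ₁ x => (IsLocalRing.maximalIdeal (Γ₁.presheaf.stalk x)).spanFinrank ≤ n)
    (spanFinrank_maximalIdeal_stalk_le_of_iso n) (fun X' σ' S' hHC => ?_) Γ e hres
  -- the horizontal-E1 closure is a chain; feed the adapter
  have hChain : ∀ (X' : Scheme.{0}) (σ : X' ⟶ P) (S : Set X'),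
      (∀ Q : (∀ X' : Scheme.{0}, (X' ⟶ P) → Set X' → Prop), Q P (𝟙 P) (Y : Set P) →
        (∀ (X' X'' : Scheme.{0}) (σ' : X' ⟶ P) (Y' : Set X') (C : X'.IdealSheafData) (τ : X'' ⟶ X'),
          Q X' σ' Y' → IsBlowup τ C → Scheme.IsRegular C.subscheme → Flat (C.subschemeι ≫ σ' ≫ q) →
          σ' '' (C.support : Set X') ⊆ {x | ¬ IsGenericPoint x (Y : Set P)} →
          (C.support : Set X') ∩ (σ' ≫ q) ⁻¹' {IsLocalRing.closedPoint O} ⊆ Y' →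
          Q X'' (τ ≫ σ') (closure (τ ⁻¹' (Y' \ (C.support : Set X'))))) → Q X' σ S) →
      Chain P (Y : Set P) X' σ S :=
    fun X' σ S h Q h0 hs => h Q h0 (fun X₁ X₂ σ' Y' C τ hQ hb hr _ hg' _ => hs X₁ X₂ σ' Y' C τ hQ hb hr hg')
  exact hMS_of_multisection O P q Y _ hChain inferInstance hY hYirr n
    (hdim_of_smoothOfRelativeDimension O P q Y _ hChain hYirr n) X' σ' S' hHC

end Summit.ResolutionOfSingularities.ResolutionOfSingularities.Cruxes.EquisingularLiftNat.Sections

end
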